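import Summits.QuantumFields.YangMills.Theorems.FlatTubeReductionValleyRelocalisationAgmonPrelim
import HarnessLib

/-!
# Variational Agmon relocalisation for the zero-flux transfer form: a near-maximiser `⊥ Ω` is re-localised to the NEAR piece of a
# two-piece angular partition at first-order cost (crux K1b `ValleyRelocalisation` of route `FlatTubeReduction`, item stmt-QuantumFields-25191;
# rung R2b1 = RECORD-label femto gap)

Seat `ym-line-ftr-p1` g2 (prover).  The elementary Hilbert-space core of proof path (ii) («IMS cut + valley gain») of the valley relocalisation,
typed ONCE for an arbitrary gauge- and twist-invariant, link-Lipschitz phase `Θ` with values in `[0, π/2]` (near piece `cos Θ · `, far piece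
`sin Θ · `) and an arbitrary action tube `T = {S ≤ η}`.

★★ `agmon_relocalise` — THE STEP.  Data: `Ω` positive physical with `K_βΩ = λ₀Ω`; a level `ν` dominating the Rayleigh quotient of every
physical `f ⊥ Ω`; a physical `φ ⊥ Ω` supported in `T` with `⟨φ,Kφ⟩ ≥ (ν − σλ₀)‖φ‖²` (a near-maximiser); a GAIN `⟨f,Kf⟩ ≤ (1−γ)λ₀‖f‖²` for physical
`f` supported in `T ∩ {sin Θ ≠ 0}`; a LOWER bound `ν ≥ (1−τ)λ₀` with `τ < γ`; the ground-state mass defect `‖Ω‖² ≤ ‖cos Θ·1_T·Ω‖² + ω‖Ω‖²`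
(`ω ≤ 1/8`; supplied by `ground_far_mass_le` of the Prelim file); and the smallness `4((σ + τω)λ₀ + ε) ≤ (γ − τ)λ₀`.
Conclusion: `ψ₀ := cos Θ·φ − b·cos Θ·1_T·Ω` (re-orthogonalised near piece) is physical, `⊥ Ω`, supported in `T ∩ {cos Θ ≠ 0}`, has `‖ψ₀‖² ≥ ‖φ‖²/4`
and Rayleigh quotient `≥ ν − (8(σ + τω) + 32ω²)λ₀ − 8ε`, `ε = ½|E|²Λ²(3/β)c_β^{|E|}` the lattice IMS defect (`qform_le_localized_cos_sin_lat`).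
Mechanism (B. Simon's IMS localisation read variationally): the far mass `‖sin Θ·φ‖²` is `≤ (σλ₀ + τωλ₀ + ε)/((γ−τ)λ₀)·‖φ‖²`, and the
re-orthogonalisation error is SECOND order because the deficit form `ν⟨·,·⟩ − ⟨·,K·⟩` is Cauchy–Schwarz-small on near-maximisers (`deficit_sq_le`).

HONEST FRAMING: Hilbert-space bookkeeping over the tree's IMS / large-field lemmas; the GAIN and the LOWER bound are hypotheses here (the gain is
RED's `ValleyGainAt` at the matching scale, the lower bound is the trial-function half of the fixed-lattice Lüscher law at level one — see the
companion file `FlatTubeReductionValleyRelocalisationOfGain.lean`).  R2b1 is a RECORD rung: nothing here concerns infinite volume, the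
continuum, or the Clay Yang–Mills mass gap.  No definitions, no named facts, no `sorry`.
-/

set_option autoImplicit false

noncomputable section

open MeasureTheory Filter Topology Real
open Literature.MathematicalPhysics.QuantumFieldTheory
open Literature.MathematicalPhysics.QuantumLattice

namespace Summit.QuantumFields.YangMills.Theorems.FemtoTransferGap

namespace ValleyReloc

open Summit.QuantumFields.YangMills.Theorems.FemtoTransferGap.OffTube

variable {L : ℕ} [NeZero L]

/-! ## The Agmon relocalisation step -/

/-- ★★ **Variational Agmon relocalisation.**  See the module docstring: a near-maximiser `φ ⊥ Ω` supported in the tube `{S ≤ η}` is re-localised to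
the near piece `{cos Θ ≠ 0}` of the angular partition, orthogonally to `Ω`, at Rayleigh cost `(8(σ + τω) + 32ω²)λ₀ + 8ε`, where
`ε = ½|E|²Λ²(3/β)c_β^{|E|}` is the lattice IMS defect of the `Λ`-link-Lipschitz phase `Θ`. [cite: SimonB1983DiscreteSpectrum, §3]
[cite: ReedSimonIV1978, Thm. XIII.1] -/
theorem agmon_relocalise {β : ℝ} (hβ : 0 < β) {Ω : GaugeConfig 3 L SU2 → ℝ} (hΩ : IsPhys Ω) (hΩpos : ∀ U, 0 < Ω U)
    (heig : transferApply β Ω = topValue su2Rep L β • Ω)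
    {Θ : GaugeConfig 3 L SU2 → ℝ} (hΘm : Measurable Θ) {Λ : ℝ} (hΛ : 0 ≤ Λ)
    (hLip : ∀ U V : GaugeConfig 3 L SU2,
      |Θ U - Θ V| ≤ Λ * ∑ e, frobNorm ((U e : Matrix (Fin 2) (Fin 2) ℂ) - (V e : Matrix (Fin 2) (Fin 2) ℂ)))
    (hΘg : ∀ (g : Site 3 L → SU2) (U : GaugeConfig 3 L SU2), Θ (gaugeTransform g U) = Θ U)
    (hΘz : ∀ (k : Fin 3), ∀ z ∈ Subgroup.center SU2, ∀ U : GaugeConfig 3 L SU2, Θ (twist k z U) = Θ U)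
    (hΘr : ∀ U, 0 ≤ Θ U ∧ Θ U ≤ π / 2)
    (η : ℝ) {φ : GaugeConfig 3 L SU2 → ℝ} (hφ : IsPhys φ) (hφΩ : l2 φ Ω = 0)
    (hφT : ∀ U, η < wilsonAction su2Rep U → φ U = 0) (hφpos : 0 < l2 φ φ)
    {ν σ γ τ ω : ℝ}
    (hν : ∀ f : GaugeConfig 3 L SU2 → ℝ, IsPhys f → l2 f Ω = 0 → qform su2Rep β f f ≤ ν * l2 f f)
    (hν2 : ν ≤ 2 * topValue su2Rep L β)
    (hσ : 0 ≤ σ) (hmax : (ν - σ * topValue su2Rep L β) * l2 φ φ ≤ qform su2Rep β φ φ)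
    (hgain : ∀ f : GaugeConfig 3 L SU2 → ℝ, IsPhys f → (∀ U, f U ≠ 0 → wilsonAction su2Rep U ≤ η ∧ Real.sin (Θ U) ≠ 0) →
      qform su2Rep β f f ≤ (1 - γ) * topValue su2Rep L β * l2 f f)
    (hτ : 0 ≤ τ) (hτ1 : τ ≤ 1) (hτγ : τ < γ) (hνlow : (1 - τ) * topValue su2Rep L β ≤ ν)
    (hω0 : 0 ≤ ω) (hω1 : ω ≤ 1 / 8)
    (hω : l2 Ω Ω ≤ l2 (fun U => Real.cos (Θ U) * {V | wilsonAction su2Rep V ≤ η}.indicator Ω U)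
        (fun U => Real.cos (Θ U) * {V | wilsonAction su2Rep V ≤ η}.indicator Ω U) + ω * l2 Ω Ω)
    (hsmall : 4 * ((σ + τ * ω) * topValue su2Rep L β +
        (1 / 2) * ((Fintype.card (Edge 3 L) : ℝ) ^ 2 * Λ ^ 2 * (3 / β) * latCE L β)) ≤ (γ - τ) * topValue su2Rep L β) :
    ∃ ψ₀ : GaugeConfig 3 L SU2 → ℝ, IsPhys ψ₀ ∧ l2 ψ₀ Ω = 0 ∧
      (∀ U, ψ₀ U ≠ 0 → wilsonAction su2Rep U ≤ η ∧ Real.cos (Θ U) ≠ 0) ∧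
      l2 φ φ ≤ 4 * l2 ψ₀ ψ₀ ∧
      (ν - (8 * (σ + τ * ω) + 32 * ω ^ 2) * topValue su2Rep L β
          - 8 * ((1 / 2) * ((Fintype.card (Edge 3 L) : ℝ) ^ 2 * Λ ^ 2 * (3 / β) * latCE L β))) * l2 ψ₀ ψ₀ ≤
        qform su2Rep β ψ₀ ψ₀ := by
  -- names
  set lam : ℝ := topValue su2Rep L β with hlam
  set ε : ℝ := (1 / 2) * ((Fintype.card (Edge 3 L) : ℝ) ^ 2 * Λ ^ 2 * (3 / β) * latCE L β) with hεdef
  set T : Set (GaugeConfig 3 L SU2) := {V | wilsonAction su2Rep V ≤ η} with hTdef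
  set cn : GaugeConfig 3 L SU2 → ℝ := fun U => Real.cos (Θ U) with hcn
  set sn : GaugeConfig 3 L SU2 → ℝ := fun U => Real.sin (Θ U) with hsn
  set g : GaugeConfig 3 L SU2 → ℝ := fun U => Real.cos (Θ U) * φ U with hgdef
  set h : GaugeConfig 3 L SU2 → ℝ := fun U => Real.sin (Θ U) * φ U with hhdef
  set ΩT : GaugeConfig 3 L SU2 → ℝ := T.indicator Ω with hΩTdef
  set w : GaugeConfig 3 L SU2 → ℝ := fun U => Real.cos (Θ U) * T.indicator Ω U with hwdef
  set r : GaugeConfig 3 L SU2 → ℝ := Ω + (-1 : ℝ) • w with hrdef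
  have hlam0 : 0 < lam := topValue_su2Rep_pos L β
  have hε0 : 0 ≤ ε := by
    rw [hεdef]; have := latCE_pos (L := L) hβ.le; positivity
  have hN : 0 < l2 Ω Ω := by
    obtain ⟨c, hc, hcle⟩ := PhysL2.exists_pos_le_of_eigen hlam0 hΩ hΩpos heig
    exact l2_pos_of_le hΩ hΩ hc hc hcle hcle
  -- range of the cut-offs
  have hcn01 : ∀ U, 0 ≤ Real.cos (Θ U) ∧ Real.cos (Θ U) ≤ 1 := fun U =>
    ⟨Real.cos_nonneg_of_neg_pi_div_two_le_of_le (by linarith only [(hΘr U).1, Real.pi_pos]) (hΘr U).2, Real.cos_le_one _⟩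
  have hcb : ∀ U, |Real.cos (Θ U)| ≤ 1 := fun U => Real.abs_cos_le_one _
  have hsb : ∀ U, |Real.sin (Θ U)| ≤ 1 := fun U => Real.abs_sin_le_one _
  have hcm : Measurable fun U => Real.cos (Θ U) := Real.continuous_cos.measurable.comp hΘm
  have hsm : Measurable fun U => Real.sin (Θ U) := Real.continuous_sin.measurable.comp hΘm
  have hcg : ∀ (k : Site 3 L → SU2) (U : GaugeConfig 3 L SU2), Real.cos (Θ (gaugeTransform k U)) = Real.cos (Θ U) :=
    fun k U => by rw [hΘg]
  have hcz : ∀ (k : Fin 3), ∀ z ∈ Subgroup.center SU2, ∀ U : GaugeConfig 3 L SU2, Real.cos (Θ (twist k z U)) = Real.cos (Θ U) :=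
    fun k z hz U => by rw [hΘz k z hz]
  have hsg : ∀ (k : Site 3 L → SU2) (U : GaugeConfig 3 L SU2), Real.sin (Θ (gaugeTransform k U)) = Real.sin (Θ U) :=
    fun k U => by rw [hΘg]
  have hsz : ∀ (k : Fin 3), ∀ z ∈ Subgroup.center SU2, ∀ U : GaugeConfig 3 L SU2, Real.sin (Θ (twist k z U)) = Real.sin (Θ U) :=
    fun k z hz U => by rw [hΘz k z hz]
  -- physical pieces
  have hg : IsPhys g := hφ.mul_of_invariant hcm (CJ := 1) hcb hcg hcz
  have hh : IsPhys h := hφ.mul_of_invariant hsm (CJ := 1) hsb hsg hsz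
  have hΩT : IsPhys ΩT := isPhys_indicator_tube η hΩ
  have hΩTc : IsPhys (Tᶜ.indicator Ω) := isPhys_indicator_tube_compl η hΩ
  have hw : IsPhys w := hΩT.mul_of_invariant hcm (CJ := 1) hcb hcg hcz
  have hr : IsPhys r := hΩ.add (hw.smul (-1))
  -- support of `φ`: inside the tube
  have hφsupp : ∀ U, φ U ≠ 0 → wilsonAction su2Rep U ≤ η := fun U hU => by
    by_contra hc; exact hU (hφT U (lt_of_not_ge hc))
  -- §A the IMS split and the norm split
  have hIMS : qform su2Rep β φ φ ≤ qform su2Rep β g g + qform su2Rep β h h + ε * l2 φ φ :=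
    qform_le_localized_cos_sin_lat hβ hΘm hΛ hLip hΘg hΘz hφ
  have hnorm : l2 g g + l2 h h = l2 φ φ := by
    unfold l2
    rw [← integral_add (hg.integrable_mul hg) (hh.integrable_mul hh)]
    refine integral_congr_ae (ae_of_all _ fun U => ?_)
    simp only [hgdef, hhdef]
    have := Real.cos_sq_add_sin_sq (Θ U)
    linear_combination (φ U ^ 2) * this
  -- §B gain on the far piece
  have hqh : qform su2Rep β h h ≤ (1 - γ) * lam * l2 h h := by
    refine hgain h hh fun U hU => ?_
    have h1 : Real.sin (Θ U) ≠ 0 := fun h0 => hU (by simp only [hhdef, h0, zero_mul])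
    have h2 : φ U ≠ 0 := fun h0 => hU (by simp only [hhdef, h0, mul_zero])
    exact ⟨hφsupp U h2, h1⟩
  -- §C the orthogonal split of the near piece against `Ω`
  obtain ⟨hgpΩ, hng, hqg⟩ := orth_split β hΩ hg heig hN
  set a : ℝ := l2 g Ω / l2 Ω Ω with ha
  have haN : a * l2 Ω Ω = l2 g Ω := div_mul_cancel₀ _ hN.ne'
  set gp : GaugeConfig 3 L SU2 → ℝ := g + (-a) • Ω with hgpdef
  have hgp : IsPhys gp := hg.add (hΩ.smul (-a))
  -- §D `⟨g,Ω⟩ = −⟨φ,r⟩` and `‖r‖² ≤ ω‖Ω‖²`, whence `a²‖Ω‖² ≤ ω‖φ‖²`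
  have hgΩ : l2 g Ω = -l2 φ r := by
    have e : l2 g Ω = l2 φ Ω - l2 φ r := by
      unfold l2
      rw [← integral_sub (hφ.integrable_mul hΩ) (hφ.integrable_mul hr)]
      refine integral_congr_ae (ae_of_all _ fun U => ?_)
      simp only [hgdef, hrdef, hwdef, Pi.add_apply, Pi.smul_apply, smul_eq_mul]
      by_cases hU : U ∈ T
      · rw [Set.indicator_of_mem hU]; ring
      · have hφ0 : φ U = 0 := by
          by_contra hne; exact hU (hφsupp U hne)
        rw [hφ0]; ring
    rw [e, hφΩ]; ring
  have hrr : l2 r r ≤ ω * l2 Ω Ω := by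
    have h1 : l2 r r ≤ l2 Ω Ω - l2 w w := by
      have hint : l2 r r = ∫ U, r U * r U ∂configMeasure SU2 L := rfl
      have hint2 : l2 Ω Ω - l2 w w = ∫ U, (Ω U * Ω U - w U * w U) ∂configMeasure SU2 L := by
        unfold l2; rw [← integral_sub (hΩ.integrable_mul hΩ) (hw.integrable_mul hw)]
      rw [hint, hint2]
      refine integral_mono (hr.integrable_mul hr) ((hΩ.integrable_mul hΩ).sub (hw.integrable_mul hw)) fun U => ?_
      simp only [hrdef, hwdef, Pi.add_apply, Pi.smul_apply, smul_eq_mul]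
      by_cases hU : U ∈ T
      · rw [Set.indicator_of_mem hU]
        have h0 := (hcn01 U).1; have h1 := (hcn01 U).2
        have hΩ2 : 0 ≤ Ω U * Ω U := mul_self_nonneg _
        have key : Ω U * Ω U - Real.cos (Θ U) * Ω U * (Real.cos (Θ U) * Ω U) -
            (Ω U + -1 * (Real.cos (Θ U) * Ω U)) * (Ω U + -1 * (Real.cos (Θ U) * Ω U)) =
            2 * (Real.cos (Θ U) * (1 - Real.cos (Θ U)) * (Ω U * Ω U)) := by ring
        have hnn : 0 ≤ 2 * (Real.cos (Θ U) * (1 - Real.cos (Θ U)) * (Ω U * Ω U)) :=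
          mul_nonneg two_pos.le (mul_nonneg (mul_nonneg h0 (sub_nonneg.2 h1)) hΩ2)
        linarith only [key, hnn]
      · rw [Set.indicator_of_notMem hU]
        have key : (Ω U + -1 * (Real.cos (Θ U) * 0)) * (Ω U + -1 * (Real.cos (Θ U) * 0)) =
            Ω U * Ω U - Real.cos (Θ U) * 0 * (Real.cos (Θ U) * 0) := by ring
        exact key.le
    linarith only [h1, hω]
  have ha2 : a ^ 2 * l2 Ω Ω ≤ ω * l2 φ φ := by
    have hcs : l2 φ r ^ 2 ≤ l2 φ φ * l2 r r := sq_l2_le hφ hr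
    have h1 : l2 g Ω ^ 2 ≤ l2 φ φ * (ω * l2 Ω Ω) := by
      rw [hgΩ, neg_sq]; exact hcs.trans (mul_le_mul_of_nonneg_left hrr hφpos.le)
    have h2 : a ^ 2 * l2 Ω Ω * l2 Ω Ω ≤ ω * l2 φ φ * l2 Ω Ω := by
      calc a ^ 2 * l2 Ω Ω * l2 Ω Ω = (a * l2 Ω Ω) ^ 2 := by ring
        _ = l2 g Ω ^ 2 := by rw [haN]
        _ ≤ l2 φ φ * (ω * l2 Ω Ω) := h1
        _ = ω * l2 φ φ * l2 Ω Ω := by ring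
    exact le_of_mul_le_mul_right h2 hN
  -- §E the far mass and the deficit of the near piece
  have hXdef : 0 ≤ ν * l2 gp gp - qform su2Rep β gp gp := sub_nonneg.2 (hν gp hgp hgpΩ)
  have hnh0 : 0 ≤ l2 h h := l2_self_nonneg h
  have hng0 : 0 ≤ l2 gp gp := l2_self_nonneg gp
  have hlamν : (lam - ν) * (a ^ 2 * l2 Ω Ω) ≤ τ * lam * (ω * l2 φ φ) := by
    have h1 : (lam - ν) * (a ^ 2 * l2 Ω Ω) ≤ τ * lam * (a ^ 2 * l2 Ω Ω) :=
      mul_le_mul_of_nonneg_right (by linarith only [hνlow]) (mul_nonneg (sq_nonneg a) hN.le)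
    exact h1.trans (mul_le_mul_of_nonneg_left ha2 (mul_nonneg hτ hlam0.le))
  -- the master inequality: `(ν − (1−γ)λ₀)‖h‖² + (ν‖g_⊥‖² − ⟨g_⊥,Kg_⊥⟩) ≤ σλ₀‖φ‖² + τλ₀ω‖φ‖² + ε‖φ‖²`
  have hmaster : (ν - (1 - γ) * lam) * l2 h h + (ν * l2 gp gp - qform su2Rep β gp gp) ≤
      (σ + τ * ω) * lam * l2 φ φ + ε * l2 φ φ := by
    have e1 : qform su2Rep β g g = qform su2Rep β gp gp + a ^ 2 * lam * l2 Ω Ω := hqg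
    have e2ν : ν * l2 g g = ν * l2 gp gp + ν * (a ^ 2 * l2 Ω Ω) := by rw [hng]; ring
    have e3 : ν * l2 g g + ν * l2 h h = ν * l2 φ φ := by rw [← hnorm]; ring
    linarith only [hIMS, hmax, hqh, hlamν, e1, e2ν, e3]
  have hγτlam : 0 < (γ - τ) * lam := mul_pos (by linarith only [hτγ]) hlam0
  have hνγ : (γ - τ) * lam ≤ ν - (1 - γ) * lam := by linarith only [hνlow]
  have hfar : (γ - τ) * lam * l2 h h ≤ (σ + τ * ω) * lam * l2 φ φ + ε * l2 φ φ := by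
    have h1 : (γ - τ) * lam * l2 h h ≤ (ν - (1 - γ) * lam) * l2 h h :=
      mul_le_mul_of_nonneg_right hνγ hnh0
    linarith only [hmaster, hXdef, h1]
  have hX : ν * l2 gp gp - qform su2Rep β gp gp ≤ (σ + τ * ω) * lam * l2 φ φ + ε * l2 φ φ := by
    have : 0 ≤ (ν - (1 - γ) * lam) * l2 h h := mul_nonneg (by linarith only [hνγ, hγτlam]) hnh0
    linarith only [hmaster, this]
  -- far mass ≤ ‖φ‖²/4
  have hfar4 : 4 * l2 h h ≤ l2 φ φ := by
    have h1 : 4 * ((γ - τ) * lam * l2 h h) ≤ (γ - τ) * lam * l2 φ φ := by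
      calc 4 * ((γ - τ) * lam * l2 h h) ≤ 4 * ((σ + τ * ω) * lam * l2 φ φ + ε * l2 φ φ) := by linarith only [hfar]
        _ = 4 * ((σ + τ * ω) * lam + ε) * l2 φ φ := by ring
        _ ≤ (γ - τ) * lam * l2 φ φ := mul_le_mul_of_nonneg_right hsmall hφpos.le
    refine le_of_mul_le_mul_left ?_ hγτlam
    calc (γ - τ) * lam * (4 * l2 h h) = 4 * ((γ - τ) * lam * l2 h h) := by ring
      _ ≤ (γ - τ) * lam * l2 φ φ := h1
  -- §F the re-orthogonalising direction `w = cos Θ·1_T·Ω`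
  have hwΩ : l2 w w ≤ l2 w Ω := by
    unfold l2
    refine integral_mono (hw.integrable_mul hw) (hw.integrable_mul hΩ) fun U => ?_
    simp only [hwdef]
    by_cases hU : U ∈ T
    · rw [Set.indicator_of_mem hU]
      have h0 := (hcn01 U).1; have h1 := (hcn01 U).2
      have hΩ2 : 0 ≤ Ω U * Ω U := mul_self_nonneg _
      have key : Real.cos (Θ U) * Ω U * Ω U - Real.cos (Θ U) * Ω U * (Real.cos (Θ U) * Ω U) =
          Real.cos (Θ U) * (1 - Real.cos (Θ U)) * (Ω U * Ω U) := by ring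
      have hnn : 0 ≤ Real.cos (Θ U) * (1 - Real.cos (Θ U)) * (Ω U * Ω U) :=
        mul_nonneg (mul_nonneg h0 (sub_nonneg.2 h1)) hΩ2
      linarith only [key, hnn]
    · rw [Set.indicator_of_notMem hU]; simp
  have hww : (1 - ω) * l2 Ω Ω ≤ l2 w w := by linarith only [hω]
  have hwΩpos : 0 < l2 w Ω := lt_of_lt_of_le (lt_of_lt_of_le (mul_pos (by linarith only [hω1]) hN) hww) hwΩ
  set b : ℝ := l2 g Ω / l2 w Ω with hb
  have hbw : b * l2 w Ω = l2 g Ω := div_mul_cancel₀ _ hwΩpos.ne'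
  -- `b²‖Ω‖² ≤ 2ω‖φ‖²`
  have hb2 : b ^ 2 * l2 Ω Ω ≤ 2 * ω * l2 φ φ := by
    have h1 : l2 g Ω ^ 2 ≤ l2 φ φ * (ω * l2 Ω Ω) := by
      rw [hgΩ, neg_sq]; exact (sq_l2_le hφ hr).trans (mul_le_mul_of_nonneg_left hrr hφpos.le)
    have h3 : (1 - ω) * l2 Ω Ω ≤ l2 w Ω := hww.trans hwΩ
    have h4 : b ^ 2 * ((1 - ω) * l2 Ω Ω) ^ 2 ≤ l2 φ φ * (ω * l2 Ω Ω) := by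
      calc b ^ 2 * ((1 - ω) * l2 Ω Ω) ^ 2 ≤ b ^ 2 * (l2 w Ω) ^ 2 := by
            refine mul_le_mul_of_nonneg_left ?_ (sq_nonneg b)
            exact pow_le_pow_left₀ (mul_nonneg (by linarith only [hω1]) hN.le) h3 2
        _ = (b * l2 w Ω) ^ 2 := by ring
        _ = l2 g Ω ^ 2 := by rw [hbw]
        _ ≤ l2 φ φ * (ω * l2 Ω Ω) := h1
    have h5 : b ^ 2 * (1 - ω) ^ 2 * l2 Ω Ω ≤ ω * l2 φ φ := by
      refine le_of_mul_le_mul_right ?_ hN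
      calc b ^ 2 * (1 - ω) ^ 2 * l2 Ω Ω * l2 Ω Ω = b ^ 2 * ((1 - ω) * l2 Ω Ω) ^ 2 := by ring
        _ ≤ l2 φ φ * (ω * l2 Ω Ω) := h4
        _ = ω * l2 φ φ * l2 Ω Ω := by ring
    have h6 : (7 / 8 : ℝ) ≤ 1 - ω := by linarith only [hω1]
    have h7 : (7 / 8 : ℝ) ^ 2 ≤ (1 - ω) ^ 2 := pow_le_pow_left₀ (by norm_num) h6 2
    have h8 : (1 : ℝ) ≤ 2 * (1 - ω) ^ 2 := by linarith only [h7]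
    have h9 : 0 ≤ b ^ 2 * l2 Ω Ω := mul_nonneg (sq_nonneg b) hN.le
    calc b ^ 2 * l2 Ω Ω ≤ b ^ 2 * l2 Ω Ω * (2 * (1 - ω) ^ 2) := le_mul_of_one_le_right h9 h8
      _ = 2 * (b ^ 2 * (1 - ω) ^ 2 * l2 Ω Ω) := by ring
      _ ≤ 2 * (ω * l2 φ φ) := by linarith only [h5]
      _ = 2 * ω * l2 φ φ := by ring
  -- §G the witness and its orthogonal decomposition `ψ₀ = g_⊥ + b·r_⊥`
  set ψ₀ : GaugeConfig 3 L SU2 → ℝ := g + (-b) • w with hψ₀def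
  have hψ₀ : IsPhys ψ₀ := hg.add (hw.smul (-b))
  have hψ₀Ω : l2 ψ₀ Ω = 0 := by
    rw [hψ₀def, l2_add_left hg (hw.smul (-b)) hΩ, l2_smul_left, ← hbw]; ring
  obtain ⟨hrpΩ, hnr, -⟩ := orth_split β hΩ hr heig hN
  set ar : ℝ := l2 r Ω / l2 Ω Ω with har
  set rp : GaugeConfig 3 L SU2 → ℝ := r + (-ar) • Ω with hrpdef
  have hrp : IsPhys rp := hr.add (hΩ.smul (-ar))
  have hdec : ψ₀ = gp + b • rp := by
    -- `ψ₀ − g_⊥ − b r_⊥ = c₀ Ω` with `c₀‖Ω‖² = ⟨ψ₀ − g_⊥ − b r_⊥, Ω⟩ = 0`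
    have hc0 : (a - b + b * ar) * l2 Ω Ω = 0 := by
      have e1 : l2 ψ₀ Ω = l2 gp Ω + b * l2 rp Ω + (a - b + b * ar) * l2 Ω Ω := by
        have : ψ₀ = gp + b • rp + (a - b + b * ar) • Ω := by
          funext U
          simp only [hψ₀def, hgpdef, hrpdef, hrdef, Pi.add_apply, Pi.smul_apply, smul_eq_mul]
          ring
        rw [this, l2_add_left (hgp.add (hrp.smul b)) (hΩ.smul _) hΩ, l2_add_left hgp (hrp.smul b) hΩ, l2_smul_left, l2_smul_left]
      rw [hψ₀Ω, hgpΩ, hrpΩ] at e1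
      linarith only [e1]
    have hc0' : a - b + b * ar = 0 := by
      rcases mul_eq_zero.1 hc0 with h0 | h0
      · exact h0
      · exact absurd h0 hN.ne'
    funext U
    have : ψ₀ U = gp U + b * rp U + (a - b + b * ar) * Ω U := by
      simp only [hψ₀def, hgpdef, hrpdef, hrdef, Pi.add_apply, Pi.smul_apply, smul_eq_mul]; ring
    rw [this, hc0']; simp
  -- §H the deficit and the norm of `ψ₀`
  have hnrp : l2 rp rp ≤ ω * l2 Ω Ω := by
    have : l2 rp rp ≤ l2 r r := by linarith only [hnr, mul_nonneg (sq_nonneg ar) hN.le]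
    exact this.trans hrr
  have hnrp0 : 0 ≤ l2 rp rp := l2_self_nonneg rp
  have hqrp0 : 0 ≤ qform su2Rep β rp rp := qform_su2Rep_self_nonneg hβ.le hrp
  have hν0 : 0 ≤ ν := le_trans (mul_nonneg (by linarith) hlam0.le) hνlow
  set X : ℝ := ν * l2 gp gp - qform su2Rep β gp gp with hXd
  set Yr : ℝ := ν * l2 rp rp - qform su2Rep β rp rp with hYrd
  have hYr0 : 0 ≤ Yr := by rw [hYrd]; linarith only [hν rp hrp hrpΩ]
  have hYr1 : Yr ≤ ν * (ω * l2 Ω Ω) := by rw [hYrd]; linarith only [mul_le_mul_of_nonneg_left hnrp hν0, hqrp0]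
  have hCS : (ν * l2 gp rp - qform su2Rep β gp rp) ^ 2 ≤ X * Yr := deficit_sq_le β ν hΩ hν hgp hrp hgpΩ hrpΩ
  -- expansions of `⟨ψ₀,Kψ₀⟩` and `‖ψ₀‖²`
  have hqψ : qform su2Rep β ψ₀ ψ₀ = qform su2Rep β gp gp + 2 * b * qform su2Rep β gp rp + b ^ 2 * qform su2Rep β rp rp := by
    rw [hdec, qform_add_add β hgp (hrp.smul b), qform_smul_right β b hgp hrp, qform_smul_left, qform_smul_right β b hrp hrp]; ring
  have hnψ : l2 ψ₀ ψ₀ = l2 gp gp + 2 * b * l2 gp rp + b ^ 2 * l2 rp rp := by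
    rw [hdec, l2_add_add hgp (hrp.smul b), l2_comm gp (b • rp), l2_smul_left, l2_comm rp gp, l2_smul_left, l2_comm rp (b • rp),
      l2_smul_left]; ring
  -- `Y := b² Yr ≤ 4λ₀ω²‖φ‖²`
  have hY : b ^ 2 * Yr ≤ 4 * lam * ω ^ 2 * l2 φ φ := by
    calc b ^ 2 * Yr ≤ b ^ 2 * (ν * (ω * l2 Ω Ω)) := mul_le_mul_of_nonneg_left hYr1 (sq_nonneg b)
      _ = ν * ω * (b ^ 2 * l2 Ω Ω) := by ring
      _ ≤ (2 * lam) * ω * (2 * ω * l2 φ φ) := by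
          refine mul_le_mul (mul_le_mul_of_nonneg_right hν2 hω0) hb2 (by positivity) (by positivity)
      _ = 4 * lam * ω ^ 2 * l2 φ φ := by ring
  -- the deficit of `ψ₀`: `ν‖ψ₀‖² − ⟨ψ₀,Kψ₀⟩ ≤ 2X + 2b²Yr`
  have hdef : ν * l2 ψ₀ ψ₀ - qform su2Rep β ψ₀ ψ₀ ≤ 2 * X + 2 * (b ^ 2 * Yr) := by
    have hP : (b * (ν * l2 gp rp - qform su2Rep β gp rp)) ^ 2 ≤ X * (b ^ 2 * Yr) := by
      calc (b * (ν * l2 gp rp - qform su2Rep β gp rp)) ^ 2 = b ^ 2 * (ν * l2 gp rp - qform su2Rep β gp rp) ^ 2 := by ring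
        _ ≤ b ^ 2 * (X * Yr) := mul_le_mul_of_nonneg_left hCS (sq_nonneg b)
        _ = X * (b ^ 2 * Yr) := by ring
    have hbY0 : 0 ≤ b ^ 2 * Yr := mul_nonneg (sq_nonneg b) hYr0
    have h2P : |2 * (b * (ν * l2 gp rp - qform su2Rep β gp rp))| ≤ X + b ^ 2 * Yr := by
      refine abs_le_of_sq_le_sq ?_ (by linarith only [hXdef, hbY0])
      linarith only [hP, sq_nonneg (X - b ^ 2 * Yr)]
    have h3 := (le_abs_self _).trans h2P
    have e : ν * l2 ψ₀ ψ₀ - qform su2Rep β ψ₀ ψ₀ = X + 2 * (b * (ν * l2 gp rp - qform su2Rep β gp rp)) + b ^ 2 * Yr := by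
      rw [hqψ, hnψ, hXd, hYrd]; ring
    rw [e]; linarith only [h3]
  -- the norm of `ψ₀`: `‖ψ₀‖² ≥ ‖g_⊥‖²/2 − b²‖r_⊥‖²`
  have hnψlow : l2 gp gp / 2 - b ^ 2 * l2 rp rp ≤ l2 ψ₀ ψ₀ := by
    have hQ : (b * l2 gp rp) ^ 2 ≤ l2 gp gp * (b ^ 2 * l2 rp rp) := by
      calc (b * l2 gp rp) ^ 2 = b ^ 2 * l2 gp rp ^ 2 := by ring
        _ ≤ b ^ 2 * (l2 gp gp * l2 rp rp) := mul_le_mul_of_nonneg_left (sq_l2_le hgp hrp) (sq_nonneg b)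
        _ = l2 gp gp * (b ^ 2 * l2 rp rp) := by ring
    have hZ0 : 0 ≤ b ^ 2 * l2 rp rp := mul_nonneg (sq_nonneg b) hnrp0
    have h2Q : |2 * (b * l2 gp rp)| ≤ l2 gp gp / 2 + 2 * (b ^ 2 * l2 rp rp) := by
      refine abs_le_of_sq_le_sq ?_ (by linarith only [hng0, hZ0])
      linarith only [hQ, sq_nonneg (l2 gp gp / 2 - 2 * (b ^ 2 * l2 rp rp))]
    have h3 : -|2 * (b * l2 gp rp)| ≤ 2 * (b * l2 gp rp) := neg_abs_le _
    rw [hnψ]; linarith only [h2Q, h3]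
  -- numerics: `‖g_⊥‖² ≥ (3/4 − ω)‖φ‖²`, `b²‖r_⊥‖² ≤ 2ω²‖φ‖²`, so `‖ψ₀‖² ≥ ‖φ‖²/4`
  have hngp : (3 / 4 - ω) * l2 φ φ ≤ l2 gp gp := by linarith only [hng, hnorm, hfar4, ha2]
  have hbr : b ^ 2 * l2 rp rp ≤ 2 * ω ^ 2 * l2 φ φ := by
    calc b ^ 2 * l2 rp rp ≤ b ^ 2 * (ω * l2 Ω Ω) := mul_le_mul_of_nonneg_left hnrp (sq_nonneg b)
      _ = ω * (b ^ 2 * l2 Ω Ω) := by ring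
      _ ≤ ω * (2 * ω * l2 φ φ) := mul_le_mul_of_nonneg_left hb2 hω0
      _ = 2 * ω ^ 2 * l2 φ φ := by ring
  have hn4 : l2 φ φ ≤ 4 * l2 ψ₀ ψ₀ := by
    have hω1' : ω * l2 φ φ ≤ 1 / 8 * l2 φ φ := mul_le_mul_of_nonneg_right hω1 hφpos.le
    have hω2 : ω ^ 2 ≤ 1 / 64 := by
      have h1 : ω * ω ≤ 1 / 8 * ω := mul_le_mul_of_nonneg_right hω1 hω0
      have h2 : 1 / 8 * ω ≤ 1 / 8 * (1 / 8 : ℝ) := by linarith only [hω1]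
      rw [sq]; linarith only [h1, h2]
    have hω2' : ω ^ 2 * l2 φ φ ≤ 1 / 64 * l2 φ φ := mul_le_mul_of_nonneg_right hω2 hφpos.le
    linarith only [hnψlow, hngp, hbr, hω1', hω2', hφpos]
  -- conclusion
  refine ⟨ψ₀, hψ₀, hψ₀Ω, fun U hU => ?_, hn4, ?_⟩
  · -- support
    have hU' : Real.cos (Θ U) * φ U + -b * (Real.cos (Θ U) * T.indicator Ω U) ≠ 0 := by
      simpa only [hψ₀def, hgdef, hwdef, Pi.add_apply, Pi.smul_apply, smul_eq_mul] using hU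
    have hc : Real.cos (Θ U) ≠ 0 := fun h0 => hU' (by rw [h0]; ring)
    refine ⟨?_, hc⟩
    by_cases hUT : U ∈ T
    · exact hUT
    · have hφ0 : φ U = 0 := by by_contra hne; exact hUT (hφsupp U hne)
      exact absurd (by rw [hφ0, Set.indicator_of_notMem hUT]; ring) hU'
  · have h1 : ν * l2 ψ₀ ψ₀ - qform su2Rep β ψ₀ ψ₀ ≤ 2 * ((σ + τ * ω) * lam * l2 φ φ + ε * l2 φ φ) + 8 * lam * ω ^ 2 * l2 φ φ := by
      linarith only [hdef, hX, hY]
    have h2 : 2 * ((σ + τ * ω) * lam * l2 φ φ + ε * l2 φ φ) + 8 * lam * ω ^ 2 * l2 φ φ ≤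
        ((8 * (σ + τ * ω) + 32 * ω ^ 2) * lam + 8 * ε) * l2 ψ₀ ψ₀ := by
      have hc : 0 ≤ 2 * ((σ + τ * ω) * lam + ε) + 8 * lam * ω ^ 2 :=
        add_nonneg (mul_nonneg two_pos.le (add_nonneg (mul_nonneg (add_nonneg hσ (mul_nonneg hτ hω0)) hlam0.le) hε0))
          (mul_nonneg (mul_nonneg (by norm_num) hlam0.le) (sq_nonneg ω))
      calc 2 * ((σ + τ * ω) * lam * l2 φ φ + ε * l2 φ φ) + 8 * lam * ω ^ 2 * l2 φ φ
          = (2 * ((σ + τ * ω) * lam + ε) + 8 * lam * ω ^ 2) * l2 φ φ := by ring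
        _ ≤ (2 * ((σ + τ * ω) * lam + ε) + 8 * lam * ω ^ 2) * (4 * l2 ψ₀ ψ₀) := mul_le_mul_of_nonneg_left hn4 hc
        _ = ((8 * (σ + τ * ω) + 32 * ω ^ 2) * lam + 8 * ε) * l2 ψ₀ ψ₀ := by ring
    linarith only [h1, h2]

end ValleyReloc

end Summit.QuantumFields.YangMills.Theorems.FemtoTransferGap

end
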